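import Literature.NumberTheory.Irrationality.RhinViola1996.ZetaTwoBaseIntegrals
import Literature.NumberTheory.LFunctions.LcmUptoCubeBound
import HarnessLib

/-!
# Rhin–Viola 1996, Theorem 2.1 — the base case: Lemma 2.1 (`i + j − l ≤ 0`) and the arithmetic shape

Topic `Literature/NumberTheory/Irrationality/RhinViola1996` (file 4 of 5). Source: G. Rhin, C. Viola, *On a permutation
group related to ζ(2)*, Acta Arith. **77** (1996) 23–56 [RhinViola1996], §2, Theorem 2.1 and Lemma 2.1 (p. 29; held
text `paper:doi-10-4064-aa-77-1-23-56`, pp. 29–31 read on the page). Everything here is PROVED; no definition, no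
named fact (finiteness/integrability of (2.1) at natural parameters is in `ZetaTwoBaseIntegrals.lean`). Contents:

* THE ARITHMETIC SHAPE of Theorem 2.1's conclusion — "`J₀ = a − bζ(2)` with `b ∈ ℤ` and `D a ∈ ℤ`" for a natural
  number `D`, written out as `∃ (a : ℚ) (b : ℤ), v = a − b·ζ(2) ∧ ∃ A : ℤ, D·a = A` (no predicate is introduced) —
  is closed under integer linear combinations and weakening `D ∣ D′` (`shape_add`, `shape_sub`, `shape_zsmul`,
  `shape_sum`, `shape_mono`, …): the bookkeeping of "a linear combination with integer coefficients of finitely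
  many integrals" (p. 31).
* "LEMMA 1.1 OF [7]" (M. Hata, *A note on Beukers' integral*, J. Austral. Math. Soc. A 58 (1995) 143–153 — not
  held; RE-DERIVED here from Beukers' lemma of `ZetaTwoBaseIntegrals.lean`, not cited as an input): for `h ≤ r ≤ R`,
  `k ≤ s ≤ S`, `d_{max{R,S}} d_{max{S−h, min{S,R}, R−k}} · I(r,0,0,s,0) ∈ ℤ + ℤζ(2)` (`shape_monomial`: on the
  diagonal `r ≤ min{R,S}`, off the diagonal `|r − s| ≤ max{R−k, S−h}` bound the denominators `m ≤ r` and `r − s`),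
  hence, expanding `(1−x)^i (1−y)^j` (`I_expand`), **`lemma21_eq`**: `I(h,i,j,k,i+j) = a − bζ(2)`, `b ∈ ℤ`,
  `d_{M₀′} d_{N₀′} a ∈ ℤ` with `M₀′ = max{h+i, j+k}`, `N₀′ = max{j+k−h, min{j+k, h+i}, h+i−k}` (p. 29).
* THE POLYNOMIAL CASE `i + j − l < 0` (**`lemma21_lt`**): the integrand is the integer polynomial
  `x^h(1−x)^i y^k(1−y)^j(1−xy)^{l−i−j−1}` of partial degrees `l+h−j−1`, `k+l−i−1`, so "`J₀ ∈ ℚ`,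
  `d_{k+l−i} d_{l+h−j} J₀ ∈ ℤ`" (`exists_rat_setIntegral_square_aeval`: `∫∫ x^r y^s = 1/((r+1)(s+1))`, `(r+1) ∣ d_A`
  for `r < A`; the two-variable analogue of `RhinViola2001.TheoremTwoOne.exists_rat_setIntegral_cube_aeval`).

Natural-number parameters throughout (the printed hypothesis `h, i, j, k, l ≥ 0`); the pair `(M₀, N₀)` of (2.4) and
the passage to `Params` with `Nonneg` are in `TheoremTwoOne.lean`. HONEST FRAMING (cell pub-zeta5: systematic search;
no irrationality claim unless certified): denominators of a 1996 family of `ζ(2)`-integrals as printed; no measure, no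
record, nothing about `ζ(5)`; records in print unmoved.

## References
* [RhinViola1996] G. Rhin, C. Viola, Acta Arith. 77 (1996) 23–56, Theorem 2.1, Lemma 2.1, Remark 2.1 (p. 29).
* [Beukers1979] F. Beukers, Bull. London Math. Soc. 11 (1979) 268–272 (via `ZetaTwoBaseIntegrals.lean`).
* M. Hata, J. Austral. Math. Soc. Ser. A 58 (1995) 143–153, Lemma 1.1 (= RV's ref. [7]; re-derived, not held).
-/

noncomputable section

open MeasureTheory Set Filter Topology
open scoped Nat

namespace Literature.NumberTheory.Irrationality.RhinViola1996

open Literature.NumberTheory.Transcendental (zetaValue)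
open Literature.NumberTheory.LFunctions (lcmUpto_dvd_lcmUpto_of_le)

/-! ### The arithmetic shape `a − bζ(2)`, `b ∈ ℤ`, `D a ∈ ℤ`: closure properties -/

/-- Weakening the denominator: `D ∣ D'`. [cite: RhinViola1996, §2, proof of Lemma 2.4, pp. 30–31] -/
theorem shape_mono {D D' : ℕ} {v : ℝ} (hD : D ∣ D')
    (hv : ∃ (a : ℚ) (b : ℤ), v = a - b * zetaValue 2 ∧ ∃ A : ℤ, (D : ℚ) * a = A) :
    ∃ (a : ℚ) (b : ℤ), v = a - b * zetaValue 2 ∧ ∃ A : ℤ, (D' : ℚ) * a = A := by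
  obtain ⟨a, b, hv, A, hA⟩ := hv
  obtain ⟨c, rfl⟩ := hD
  refine ⟨a, b, hv, c * A, ?_⟩
  push_cast
  rw [← hA]; ring

/-- Sums. [cite: RhinViola1996, §2, proof of Lemma 2.4, p. 31 ("a linear combination with integer coefficients")] -/
theorem shape_add {D : ℕ} {v w : ℝ}
    (hv : ∃ (a : ℚ) (b : ℤ), v = a - b * zetaValue 2 ∧ ∃ A : ℤ, (D : ℚ) * a = A)
    (hw : ∃ (a : ℚ) (b : ℤ), w = a - b * zetaValue 2 ∧ ∃ A : ℤ, (D : ℚ) * a = A) :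
    ∃ (a : ℚ) (b : ℤ), v + w = a - b * zetaValue 2 ∧ ∃ A : ℤ, (D : ℚ) * a = A := by
  obtain ⟨a, b, hv, A, hA⟩ := hv
  obtain ⟨a', b', hw, A', hA'⟩ := hw
  refine ⟨a + a', b + b', ?_, A + A', ?_⟩
  · rw [hv, hw]; push_cast; ring
  · push_cast; rw [mul_add, hA, hA']

/-- Differences. [cite: RhinViola1996, §2, proof of Lemma 2.4, p. 31] -/
theorem shape_sub {D : ℕ} {v w : ℝ}
    (hv : ∃ (a : ℚ) (b : ℤ), v = a - b * zetaValue 2 ∧ ∃ A : ℤ, (D : ℚ) * a = A)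
    (hw : ∃ (a : ℚ) (b : ℤ), w = a - b * zetaValue 2 ∧ ∃ A : ℤ, (D : ℚ) * a = A) :
    ∃ (a : ℚ) (b : ℤ), v - w = a - b * zetaValue 2 ∧ ∃ A : ℤ, (D : ℚ) * a = A := by
  obtain ⟨a, b, hv, A, hA⟩ := hv
  obtain ⟨a', b', hw, A', hA'⟩ := hw
  refine ⟨a - a', b - b', ?_, A - A', ?_⟩
  · rw [hv, hw]; push_cast; ring
  · push_cast; rw [mul_sub, hA, hA']

/-- Integer multiples. [cite: RhinViola1996, §2, proof of Lemma 2.4, p. 31] -/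
theorem shape_zsmul {D : ℕ} {v : ℝ} (c : ℤ)
    (hv : ∃ (a : ℚ) (b : ℤ), v = a - b * zetaValue 2 ∧ ∃ A : ℤ, (D : ℚ) * a = A) :
    ∃ (a : ℚ) (b : ℤ), c * v = a - b * zetaValue 2 ∧ ∃ A : ℤ, (D : ℚ) * a = A := by
  obtain ⟨a, b, hv, A, hA⟩ := hv
  refine ⟨c * a, c * b, ?_, c * A, ?_⟩
  · rw [hv]; push_cast; ring
  · push_cast; rw [mul_left_comm, hA]

/-- The coefficient `−1` of the printed decompositions. [cite: RhinViola1996, §2, proof of Lemma 2.4, p. 31] -/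
theorem shape_neg_one_mul {D : ℕ} {v : ℝ}
    (hv : ∃ (a : ℚ) (b : ℤ), v = a - b * zetaValue 2 ∧ ∃ A : ℤ, (D : ℚ) * a = A) :
    ∃ (a : ℚ) (b : ℤ), (-1 : ℝ) * v = a - b * zetaValue 2 ∧ ∃ A : ℤ, (D : ℚ) * a = A := by
  have h := shape_zsmul (-1) hv
  push_cast at h
  exact h

/-- The coefficient `1` of the printed decompositions. [cite: RhinViola1996, §2, proof of Lemma 2.4, p. 31] -/
theorem shape_one_mul {D : ℕ} {v : ℝ}
    (hv : ∃ (a : ℚ) (b : ℤ), v = a - b * zetaValue 2 ∧ ∃ A : ℤ, (D : ℚ) * a = A) :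
    ∃ (a : ℚ) (b : ℤ), (1 : ℝ) * v = a - b * zetaValue 2 ∧ ∃ A : ℤ, (D : ℚ) * a = A := by
  rw [one_mul]; exact hv

/-- The coefficient `0` (padding of the two-term decomposition of the proof of Theorem 2.1 to three terms).
[cite: RhinViola1996, §2, proof of Theorem 2.1, p. 31] -/
theorem shape_zero_mul {D : ℕ} (v : ℝ) :
    ∃ (a : ℚ) (b : ℤ), (0 : ℝ) * v = a - b * zetaValue 2 ∧ ∃ A : ℤ, (D : ℚ) * a = A :=
  ⟨0, 0, by simp, 0, by simp⟩

/-- Finite integer combinations. [cite: RhinViola1996, §2, proof of Lemma 2.4, p. 31] -/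
theorem shape_sum {D : ℕ} {ι : Type*} (s : Finset ι) (c : ι → ℤ) (v : ι → ℝ)
    (hv : ∀ x ∈ s, ∃ (a : ℚ) (b : ℤ), v x = a - b * zetaValue 2 ∧ ∃ A : ℤ, (D : ℚ) * a = A) :
    ∃ (a : ℚ) (b : ℤ), ∑ x ∈ s, (c x : ℝ) * v x = a - b * zetaValue 2 ∧ ∃ A : ℤ, (D : ℚ) * a = A := by
  classical
  induction s using Finset.induction_on with
  | empty => exact ⟨0, 0, by simp, 0, by simp⟩
  | insert x s hx ih =>
    rw [Finset.sum_insert hx]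
    exact shape_add (shape_zsmul (c x) (hv x (Finset.mem_insert_self x s)))
      (ih fun y hy => hv y (Finset.mem_insert_of_mem hy))

/-- A rational value with `D v ∈ ℤ` has the shape with `b = 0`. [cite: RhinViola1996, §2 Lemma 2.1 (proof, case
`i+j−l < 0`: "`J₀ ∈ ℚ`"), p. 29] -/
theorem shape_of_rat {D : ℕ} {v : ℝ} {q : ℚ} (hv : v = q) (hq : ∃ A : ℤ, (D : ℚ) * q = A) :
    ∃ (a : ℚ) (b : ℤ), v = a - b * zetaValue 2 ∧ ∃ A : ℤ, (D : ℚ) * a = A :=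
  ⟨q, 0, by rw [hv]; simp, hq⟩

/-! ### The arithmetic of Beukers' kernels ("Lemma 1.1 of [7]" = Hata 1995): `d_M d_N I(r,0,0,s,0) ∈ ℤ + ℤζ(2)` -/

/-- `m ∣ d_M` for `1 ≤ m ≤ M`, as an exact division in `ℚ`. [folklore] -/
private theorem cast_lcmUpto_div {M m : ℕ} (hm : 1 ≤ m) (hmM : m ≤ M) :
    ((Nat.lcmUpto M / m : ℕ) : ℚ) * (m : ℚ) = Nat.lcmUpto M := by
  have hdvd : m ∣ Nat.lcmUpto M := by
    rw [Nat.lcmUpto]; exact Finset.dvd_lcm (Finset.mem_Icc.2 ⟨hm, hmM⟩)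
  exact_mod_cast Nat.div_mul_cancel hdvd

/-- Diagonal kernels: `I(r,0,0,r,0) = −Σ_{m ≤ r} m⁻² + ζ(2)` and `d_M d_N Σ_{m ≤ r} m⁻² ∈ ℤ` whenever `r ≤ M`,
`r ≤ N`. [cite: RhinViola1996, §2 Lemma 2.1 (proof, case `i+j−l = 0`), p. 29] -/
theorem shape_monomial_diag {r M N : ℕ} (hrM : r ≤ M) (hrN : r ≤ N) :
    ∃ (a : ℚ) (b : ℤ), I ⟨r, 0, 0, r, 0⟩ = a - b * zetaValue 2 ∧
      ∃ A : ℤ, ((Nat.lcmUpto M * Nat.lcmUpto N : ℕ) : ℚ) * a = A := by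
  refine ⟨-∑ m ∈ Finset.range r, 1 / ((m : ℚ) + 1) ^ 2, -1, ?_,
    -∑ m ∈ Finset.range r, ((Nat.lcmUpto M / (m + 1) : ℕ) : ℤ) * ((Nat.lcmUpto N / (m + 1) : ℕ) : ℤ), ?_⟩
  · rw [I_monomial_diag]; push_cast; ring
  · rw [mul_neg, Finset.mul_sum]
    simp only [Int.cast_neg, Int.cast_sum, Int.cast_mul, Int.cast_natCast, Nat.cast_mul, neg_inj]
    refine Finset.sum_congr rfl fun m hm => ?_
    rw [Finset.mem_range] at hm
    rw [← cast_lcmUpto_div (m := m + 1) (by omega) (by omega), ← cast_lcmUpto_div (M := N) (m := m + 1) (by omega)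
      (by omega)]
    have : ((m : ℚ) + 1) ≠ 0 := by positivity
    rw [Nat.cast_succ]
    field_simp

/-- Off-diagonal kernels above the diagonal: for `s < r`, `I(r,0,0,s,0) = (Σ_{s<m≤r} 1/m)/(r−s) ∈ ℚ` and
`d_M d_N I(r,0,0,s,0) ∈ ℤ` whenever `r ≤ M` and `r − s ≤ N`.
[cite: RhinViola1996, §2 Lemma 2.1 (proof), p. 29] -/
theorem shape_monomial_offDiag {r s M N : ℕ} (h : s < r) (hrM : r ≤ M) (hN : r - s ≤ N) :
    ∃ (a : ℚ) (b : ℤ), I ⟨r, 0, 0, s, 0⟩ = a - b * zetaValue 2 ∧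
      ∃ A : ℤ, ((Nat.lcmUpto M * Nat.lcmUpto N : ℕ) : ℚ) * a = A := by
  refine shape_of_rat (q := (∑ m ∈ Finset.Ioc s r, 1 / (m : ℚ)) / ((r : ℚ) - s)) ?_
    ⟨∑ m ∈ Finset.Ioc s r, ((Nat.lcmUpto M / m : ℕ) : ℤ) * ((Nat.lcmUpto N / (r - s) : ℕ) : ℤ), ?_⟩
  · rw [I_monomial_offDiag h]; push_cast; rfl
  · have hrs : ((r : ℚ) - s) = ((r - s : ℕ) : ℚ) := by rw [Nat.cast_sub h.le]
    rw [hrs, mul_div_assoc', Finset.mul_sum, Finset.sum_div]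
    simp only [Int.cast_sum, Int.cast_mul, Int.cast_natCast, Nat.cast_mul]
    refine Finset.sum_congr rfl fun m hm => ?_
    rw [Finset.mem_Ioc] at hm
    rw [← cast_lcmUpto_div (m := m) (by omega) (by omega),
      ← cast_lcmUpto_div (M := N) (m := r - s) (by omega) hN]
    have : (m : ℚ) ≠ 0 := by exact_mod_cast (show m ≠ 0 by omega)
    have : ((r - s : ℕ) : ℚ) ≠ 0 := by exact_mod_cast (show r - s ≠ 0 by omega)
    field_simp

/-- Off-diagonal kernels below the diagonal: for `r < s`, `d_M d_N I(r,0,0,s,0) ∈ ℤ` whenever `s ≤ M` and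
`s − r ≤ N`. [cite: RhinViola1996, §2 Lemma 2.1 (proof), p. 29] -/
theorem shape_monomial_offDiag' {r s M N : ℕ} (h : r < s) (hsM : s ≤ M) (hN : s - r ≤ N) :
    ∃ (a : ℚ) (b : ℤ), I ⟨r, 0, 0, s, 0⟩ = a - b * zetaValue 2 ∧
      ∃ A : ℤ, ((Nat.lcmUpto M * Nat.lcmUpto N : ℕ) : ℚ) * a = A := by
  have hσ := invariance_sigma ⟨s, 0, 0, r, 0⟩
  simp only [sigma] at hσ
  rw [hσ]
  exact shape_monomial_offDiag h hsM hN

/-- **The bookkeeping of "Lemma 1.1 of [7]"** in the form used on p. 29: for all `r, s` with `r ≤ R`, `s ≤ S`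
(`R = h+i`, `S = j+k` the degrees) and `r ≥ h`, `s ≥ k`: `d_{M'} d_{N'} I(r,0,0,s,0) ∈ ℤ + ℤζ(2)` with
`M' = max{R, S}`, `N' = max{S − h, min{S, R}, R − k}`. [cite: RhinViola1996, §2 Lemma 2.1 (proof), p. 29] -/
theorem shape_monomial {r s h k R S : ℕ} (hr : h ≤ r) (hrR : r ≤ R) (hs : k ≤ s) (hsS : s ≤ S) :
    ∃ (a : ℚ) (b : ℤ), I ⟨r, 0, 0, s, 0⟩ = a - b * zetaValue 2 ∧
      ∃ A : ℤ, ((Nat.lcmUpto (max R S) * Nat.lcmUpto (max (max (S - h) (min S R)) (R - k)) : ℕ) : ℚ) * a = A := by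
  rcases lt_trichotomy s r with hlt | heq | hgt
  · exact shape_monomial_offDiag hlt (le_max_of_le_left hrR) (by omega)
  · subst heq
    exact shape_monomial_diag (le_max_of_le_left hrR) (by omega)
  · exact shape_monomial_offDiag' hgt (le_max_of_le_right hsS) (by omega)

/-! ### Lemma 2.1, case `i + j = l`: expansion onto Beukers' kernels -/

/-- Pointwise expansion `x^h(1−x)^i y^k(1−y)^j/(1−xy) = Σ_{u,v} (−1)^{u+v} C(i,u) C(j,v) · x^{h+u} y^{k+v}/(1−xy)` on
the square. [cite: RhinViola1996, §2 Lemma 2.1 (proof, case `i+j−l = 0`), p. 29] -/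
theorem integrand_expand (h i j k : ℕ) {p : Fin 2 → ℝ} (hp : p ∈ square) :
    integrand ⟨h, i, j, k, (i + j : ℕ)⟩ p =
      ∑ u ∈ Finset.range (i + 1), ∑ v ∈ Finset.range (j + 1),
        (((-1) ^ (u + v) * (i.choose u : ℤ) * (j.choose v : ℤ) : ℤ) : ℝ) * integrand ⟨(h + u : ℕ), 0, 0, (k + v : ℕ), 0⟩ p := by
  have hW := (one_sub_mul_pos hp).ne'
  rw [integrand_natCast h i j k (i + j) hp]
  simp_rw [integrand_monomial]
  rw [pow_succ, div_mul_eq_div_div, mul_div_assoc, div_self (pow_ne_zero _ hW), mul_one]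
  have hx : (1 - p 0) ^ i = ∑ u ∈ Finset.range (i + 1), (-1 : ℝ) ^ u * (i.choose u : ℝ) * p 0 ^ u := by
    rw [sub_eq_add_neg, add_comm, add_pow]
    refine Finset.sum_congr rfl fun u _ => ?_
    rw [one_pow, mul_one, neg_pow, mul_comm ((-1 : ℝ) ^ u)]; ring
  have hy : (1 - p 1) ^ j = ∑ v ∈ Finset.range (j + 1), (-1 : ℝ) ^ v * (j.choose v : ℝ) * p 1 ^ v := by
    rw [sub_eq_add_neg, add_comm, add_pow]
    refine Finset.sum_congr rfl fun v _ => ?_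
    rw [one_pow, mul_one, neg_pow, mul_comm ((-1 : ℝ) ^ v)]; ring
  rw [hx, hy]
  set A := ∑ u ∈ Finset.range (i + 1), (-1 : ℝ) ^ u * (i.choose u : ℝ) * p 0 ^ u with hA
  set B := ∑ v ∈ Finset.range (j + 1), (-1 : ℝ) ^ v * (j.choose v : ℝ) * p 1 ^ v with hB
  calc p 0 ^ h * A * p 1 ^ k * B / (1 - p 0 * p 1) = p 0 ^ h * p 1 ^ k / (1 - p 0 * p 1) * (A * B) := by ring
    _ = p 0 ^ h * p 1 ^ k / (1 - p 0 * p 1) * ∑ u ∈ Finset.range (i + 1), ∑ v ∈ Finset.range (j + 1),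
          ((-1 : ℝ) ^ u * (i.choose u : ℝ) * p 0 ^ u) * ((-1 : ℝ) ^ v * (j.choose v : ℝ) * p 1 ^ v) := by
        rw [hA, hB, Finset.sum_mul_sum]
    _ = _ := by
        rw [Finset.mul_sum]
        refine Finset.sum_congr rfl fun u _ => ?_
        rw [Finset.mul_sum]
        refine Finset.sum_congr rfl fun v _ => ?_
        push_cast
        rw [pow_add, pow_add, pow_add]
        ring

/-- `I(h,i,j,k,i+j)` as an integer combination of Beukers' kernels `I(h+u,0,0,k+v,0)`, `u ≤ i`, `v ≤ j`.
[cite: RhinViola1996, §2 Lemma 2.1 (proof, case `i+j−l = 0`), p. 29] -/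
theorem I_expand (h i j k : ℕ) :
    I ⟨h, i, j, k, (i + j : ℕ)⟩ =
      ∑ u ∈ Finset.range (i + 1), ∑ v ∈ Finset.range (j + 1),
        (((-1) ^ (u + v) * (i.choose u : ℤ) * (j.choose v : ℤ) : ℤ) : ℝ) * I ⟨(h + u : ℕ), 0, 0, (k + v : ℕ), 0⟩ := by
  unfold I
  rw [setIntegral_congr_fun measurableSet_square fun p hp => integrand_expand h i j k hp,
    integral_finsetSum _ fun u _ => integrable_finsetSum _ fun v _ =>
      (integrableOn_integrand_monomial (h + u) (k + v)).const_mul _]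
  refine Finset.sum_congr rfl fun u _ => ?_
  rw [integral_finsetSum _ fun v _ => (integrableOn_integrand_monomial (h + u) (k + v)).const_mul _]
  refine Finset.sum_congr rfl fun v _ => ?_
  exact integral_const_mul _ _

/-- **Lemma 2.1, case `i + j − l = 0`** ("by Lemma 1.1 in [7] we have `J₀ = a − bζ(2)` with `b ∈ ℤ` and
`d_{M₀′} d_{N₀′} a ∈ ℤ`, where `M₀′ = max{h+i, j+k} = M₀` and `N₀′ = max{j+k−h, min{j+k, h+i}, h+i−k} = N₀`").
[cite: RhinViola1996, §2 Lemma 2.1, p. 29] -/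
theorem lemma21_eq (h i j k : ℕ) :
    ∃ (a : ℚ) (b : ℤ), I ⟨h, i, j, k, (i + j : ℕ)⟩ = a - b * zetaValue 2 ∧
      ∃ A : ℤ, ((Nat.lcmUpto (max (h + i) (j + k)) *
        Nat.lcmUpto (max (max (j + k - h) (min (j + k) (h + i))) (h + i - k)) : ℕ) : ℚ) * a = A := by
  rw [I_expand]
  have main := shape_sum (D := Nat.lcmUpto (max (h + i) (j + k)) *
      Nat.lcmUpto (max (max (j + k - h) (min (j + k) (h + i))) (h + i - k)))
    (Finset.range (i + 1) ×ˢ Finset.range (j + 1))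
    (fun uv => (-1) ^ (uv.1 + uv.2) * (i.choose uv.1 : ℤ) * (j.choose uv.2 : ℤ))
    (fun uv => I ⟨(h + uv.1 : ℕ), 0, 0, (k + uv.2 : ℕ), 0⟩) fun uv huv => by
      rw [Finset.mem_product, Finset.mem_range, Finset.mem_range] at huv
      exact shape_monomial (R := h + i) (S := j + k) (by omega) (by omega) (by omega) (by omega)
  rw [Finset.sum_product] at main
  exact main

/-! ### Lemma 2.1, case `i + j − l < 0`: the polynomial case -/

/-- Evaluation of an integer bivariate polynomial as a finite sum of monomials. [folklore] -/
private theorem aeval_eq_sum_coeff (f : MvPolynomial (Fin 2) ℤ) (v : Fin 2 → ℝ) :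
    MvPolynomial.aeval v f = ∑ d ∈ f.support, ((MvPolynomial.coeff d f : ℤ) : ℝ) * (v 0 ^ d 0 * v 1 ^ d 1) := by
  rw [MvPolynomial.aeval_def, MvPolynomial.eval₂_eq']
  refine Finset.sum_congr rfl fun d _ => ?_
  rw [Fin.prod_univ_two]
  simp

/-- **`d_A d_B ∫∫_{(0,1)²} f ∈ ℤ`** for an integer polynomial `f(x,y)` with `deg_x f < A`, `deg_y f < B` ("since
`∫∫ x^r y^s dx dy = 1/((r+1)(s+1))` … we have `J₀ ∈ ℚ`, `d_{k+l−i} d_{l+h−j} J₀ ∈ ℤ`").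
[cite: RhinViola1996, §2 Lemma 2.1 (proof, case `i+j−l < 0`), p. 29] -/
theorem exists_rat_setIntegral_square_aeval (f : MvPolynomial (Fin 2) ℤ) {A B : ℕ}
    (hA : f.degreeOf 0 < A) (hB : f.degreeOf 1 < B) :
    ∃ ρ : ℚ, (∫ p in square, (MvPolynomial.aeval p f : ℝ)) = ρ ∧
      ∃ z : ℤ, ((Nat.lcmUpto A * Nat.lcmUpto B : ℕ) : ℚ) * ρ = z := by
  refine ⟨∑ d ∈ f.support, ((MvPolynomial.coeff d f : ℤ) : ℚ) / (((d 0 : ℚ) + 1) * ((d 1 : ℚ) + 1)), ?_,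
    ∑ d ∈ f.support, MvPolynomial.coeff d f * (((Nat.lcmUpto A / (d 0 + 1) : ℕ) : ℤ) *
      ((Nat.lcmUpto B / (d 1 + 1) : ℕ) : ℤ)), ?_⟩
  · simp only [aeval_eq_sum_coeff]
    rw [integral_finsetSum _ fun d _ => (integral_monomial (d 0) (d 1)).1.const_mul _]
    push_cast
    refine Finset.sum_congr rfl fun d _ => ?_
    rw [integral_const_mul, (integral_monomial (d 0) (d 1)).2]
    ring
  · rw [Finset.mul_sum]
    simp only [Int.cast_sum, Int.cast_mul, Int.cast_natCast, Nat.cast_mul]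
    refine Finset.sum_congr rfl fun d hd => ?_
    have h0 : d 0 < A := lt_of_le_of_lt (MvPolynomial.monomial_le_degreeOf 0 hd) hA
    have h1 : d 1 < B := lt_of_le_of_lt (MvPolynomial.monomial_le_degreeOf 1 hd) hB
    rw [← cast_lcmUpto_div (m := d 0 + 1) (by omega) h0, ← cast_lcmUpto_div (m := d 1 + 1) (by omega) h1]
    have : ((d 0 : ℚ) + 1) ≠ 0 := by positivity
    have : ((d 1 : ℚ) + 1) ≠ 0 := by positivity
    push_cast
    field_simp

/-- Partial degrees of `S = X₀^h (1−X₀)^i X₁^k (1−X₁)^j (1 − X₀X₁)^e ∈ ℤ[X₀,X₁]`: `deg_x S ≤ h+i+e`,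
`deg_y S ≤ k+j+e`. [cite: RhinViola1996, §2 Lemma 2.1 (proof), p. 29] -/
theorem degreeOf_rvPoly_le (h i j k e : ℕ) (n : Fin 2) :
    (MvPolynomial.X 0 ^ h * (1 - MvPolynomial.X 0) ^ i * MvPolynomial.X 1 ^ k * (1 - MvPolynomial.X 1) ^ j *
        (1 - MvPolynomial.X 0 * MvPolynomial.X 1) ^ e : MvPolynomial (Fin 2) ℤ).degreeOf n ≤
      h * (if n = 0 then 1 else 0) + i * (if n = 0 then 1 else 0) + k * (if n = 1 then 1 else 0) +
        j * (if n = 1 then 1 else 0) + e := by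
  have hX : ∀ n m : Fin 2, (MvPolynomial.X m : MvPolynomial (Fin 2) ℤ).degreeOf n = if n = m then 1 else 0 :=
    fun n m => MvPolynomial.degreeOf_X n m
  have a1 : ∀ m : Fin 2, ((1 : MvPolynomial (Fin 2) ℤ) - MvPolynomial.X m).degreeOf n ≤ if n = m then 1 else 0 :=
    fun m => (MvPolynomial.degreeOf_sub_le _ _ _).trans (by rw [MvPolynomial.degreeOf_one, hX]; simp)
  have a3 : ((1 : MvPolynomial (Fin 2) ℤ) - MvPolynomial.X 0 * MvPolynomial.X 1).degreeOf n ≤ 1 := by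
    refine (MvPolynomial.degreeOf_sub_le _ _ _).trans (max_le (by rw [MvPolynomial.degreeOf_one]; omega) ?_)
    have b1 := MvPolynomial.degreeOf_mul_le n (MvPolynomial.X 0 : MvPolynomial (Fin 2) ℤ) (MvPolynomial.X 1)
    rw [hX, hX] at b1
    fin_cases n <;> simp at b1 ⊢ <;> omega
  have e1 := (MvPolynomial.degreeOf_pow_le n (MvPolynomial.X 0 : MvPolynomial (Fin 2) ℤ) h).trans
    (Nat.mul_le_mul_left h (le_of_eq (hX n 0)))
  have e2 := (MvPolynomial.degreeOf_pow_le n _ i).trans (Nat.mul_le_mul_left i (a1 0))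
  have e3 := (MvPolynomial.degreeOf_pow_le n (MvPolynomial.X 1 : MvPolynomial (Fin 2) ℤ) k).trans
    (Nat.mul_le_mul_left k (le_of_eq (hX n 1)))
  have e4 := (MvPolynomial.degreeOf_pow_le n _ j).trans (Nat.mul_le_mul_left j (a1 1))
  have e5 := (MvPolynomial.degreeOf_pow_le n _ e).trans (Nat.mul_le_mul_left e a3)
  have m1 := MvPolynomial.degreeOf_mul_le n (MvPolynomial.X 0 ^ h : MvPolynomial (Fin 2) ℤ) ((1 - MvPolynomial.X 0) ^ i)
  have m2 := MvPolynomial.degreeOf_mul_le n (MvPolynomial.X 0 ^ h * (1 - MvPolynomial.X 0) ^ i : MvPolynomial (Fin 2) ℤ)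
    (MvPolynomial.X 1 ^ k)
  have m3 := MvPolynomial.degreeOf_mul_le n
    (MvPolynomial.X 0 ^ h * (1 - MvPolynomial.X 0) ^ i * MvPolynomial.X 1 ^ k : MvPolynomial (Fin 2) ℤ)
    ((1 - MvPolynomial.X 1) ^ j)
  have m4 := MvPolynomial.degreeOf_mul_le n
    (MvPolynomial.X 0 ^ h * (1 - MvPolynomial.X 0) ^ i * MvPolynomial.X 1 ^ k * (1 - MvPolynomial.X 1) ^ j :
      MvPolynomial (Fin 2) ℤ) ((1 - MvPolynomial.X 0 * MvPolynomial.X 1) ^ e)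
  omega

/-- **Lemma 2.1, case `i + j − l < 0`** ("since `∫∫ x^r y^s dx dy = 1/((r+1)(s+1))` for `r, s ≥ 0`, we have
`J₀ ∈ ℚ`, `d_{k+l−i} d_{l+h−j} J₀ ∈ ℤ`"), at natural parameters with `l = i + j + e + 1`: the integrand is the
integer polynomial `x^h(1−x)^i y^k(1−y)^j (1−xy)^e` of partial degrees `≤ h+i+e = l+h−j−1`, `≤ k+j+e = k+l−i−1`.
[cite: RhinViola1996, §2 Lemma 2.1, p. 29] -/
theorem lemma21_lt (h i j k e : ℕ) :
    ∃ ρ : ℚ, I ⟨h, i, j, k, (i + j + e + 1 : ℕ)⟩ = ρ ∧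
      ∃ z : ℤ, ((Nat.lcmUpto (h + i + e + 1) * Nat.lcmUpto (k + j + e + 1) : ℕ) : ℚ) * ρ = z := by
  obtain ⟨ρ, hρ, hz⟩ := exists_rat_setIntegral_square_aeval
    (MvPolynomial.X 0 ^ h * (1 - MvPolynomial.X 0) ^ i * MvPolynomial.X 1 ^ k * (1 - MvPolynomial.X 1) ^ j *
        (1 - MvPolynomial.X 0 * MvPolynomial.X 1) ^ e : MvPolynomial (Fin 2) ℤ)
    (A := h + i + e + 1) (B := k + j + e + 1)
    (by have := degreeOf_rvPoly_le h i j k e 0; simp at this; omega)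
    (by have := degreeOf_rvPoly_le h i j k e 1; simp at this; omega)
  refine ⟨ρ, ?_, hz⟩
  rw [← hρ]
  unfold I
  refine setIntegral_congr_fun measurableSet_square fun p hp => ?_
  have hW := (one_sub_mul_pos hp).ne'
  rw [integrand_natCast h i j k (i + j + e + 1) hp]
  simp only [map_mul, map_pow, map_sub, map_one, MvPolynomial.aeval_X]
  rw [div_eq_iff (pow_ne_zero _ hW)]
  ring

end Literature.NumberTheory.Irrationality.RhinViola1996

end
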